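import Summits.Ventures.Crystal3D.Theorems.StickyWulffConstantTextureLiminfTexShadowLevelReachHexagonPooledFlux
import Summits.Ventures.Crystal3D.Theorems.StickyWulffConstantCoaxialWallLawSeamGradedRow
import Summits.Ventures.Crystal3D.Theorems.StickyWulffConstantCoaxialWallLawRowsOfJoint
import HarnessLib

/-!
# GLUE (a1): lane F's graded row certificate BY NAME ⇒ the abstract local row of the (β) plate censuses, per family; the honest two-family bound under it
# (lane T, crux `TextureLiminfV5`, stmt-Ventures-23912, registered stub `stub_terraceCensus`; cf-p1 (ccxcvii)(2) / (ccxcviii) (a1); HOME/wall-p1-g23/BETA-PLATES-g23.md §5)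

HONEST FRAMING. Venture `Summits/Ventures/Crystal3D` (cell `crystal3d-full`), route `route-Ventures-StickyWulffConstant`, helper `--supports` the law-v5
crux `TextureLiminfV5` (stmt-Ventures-23912), lane T.  CONDITIONAL results: the hypotheses `TailResidue.ThreePayer` and
`TailResidue.UnionCoreGradedCapWin₃ s` are lane F's NAMED INPUTS (…SeamThreePayer, …SeamGradedRow p744070; lane F registers the `2√6` instance, lane T needs
`s = 9/2` — neither is proved here or anywhere yet); `KissingGap δ` / `KissingClassification δ` by name.  Nothing about energies; F-C1 not moved.

THE GLUE (cf-p1 (ccxcviii) item (a1), «waits for nobody»).  Lane F's certificate is a SINGLE-COAXIAL-FAMILY row: `UnionCoreGradedCapWin₃ s` (+ `ThreePayer`)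
gives `localSummandA v2 (basalSystem L) (basalSystem (H ≫ L)) ≤ s` at every payer for EVERY frame `L` (`localSummandA_le_of_threePayer_of_gradedWin₃`), i.e.
`LocalEndRowA v2 s (basalSystem L) (basalSystem (H ≫ L))` (`localEndRowA_basal_of_gradedWin₃`; `LocalEndRowA` IS «summand ≤ s», `localEndRowA_iff`).  The (β)
censuses instantiate the systems `⟨Fr, inPlaneRoots Fr 1⟩` (bottom, rising) — a SUB-system of `basalSystem Fr` (`inPlaneRoots_subset_basalHexagon`,
`PlateSystem.adm_mono`) — so by antitonicity in the admissible classes (`localEndRowA_of_systems`, …RowsOfJoint) the row holds for the pair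
`(⟨Fr, RT↑⟩, ⟨Fr, RT↑⟩)` (`localEndRowA_inPlane_of_gradedWin₃`), which is all `hexagon_barlow_flux_le_payers_cuts` (…HexagonRow) asks (its `S₂` is free); the
top family likewise at the frame `G₂ ≫ bM` (…HexagonTop).  Payer-side currency: `LocalEndRowA`'s `pooledDef` / `Σ_PAYW (12 − deg)` is exactly what
`card_endPairs_le_of_localRow` consumes — no further transport.  Version: `WordVersion.v2` (the certificate's), a legal instance of the censuses' `ver`.
* `hexagon_barlow_flux_le_payers_cuts_of_gradedWin₃`, `hexagon_barlow_flux_le_payers_cuts_top_of_gradedWin₃` — each plate's hexagon flux bound CONDITIONAL on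
  lane F's two named inputs at the line `s`, no other row hypothesis;
* **`hexagon_twoPlate_flux_le_twice_payerSum_of_gradedWin₃`** — the HONEST two-family bound under lane F's certificate SHAPE (two applications of the row, one per
  family): `flux₁ + flux₂ ≤ 2·s·Σ_PAY (12 − deg) + ΣCUT₁ + ΣCUT₂ + (6912·s + 1710720)·ρ` — the factor `2` is the TRIPWIRE of the memo §5: ONE application
  (`hexagon_twoPlate_flux_le_payerSum`, factor `1`) needs the BI-FAMILY row (cf-p1 (ccxcviii) item (a2), a new named input), which this certificate is not.
WHAT THIS IS NOT: the certificate, `ThreePayer`, the bi-family row, the flux-to-area step; F-C1 not moved.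
-/

noncomputable section

namespace Summit.Ventures.Crystal3D.Theorems

open Summit.Ventures.Crystal3D Finset
open Literature.MathematicalPhysics.StatisticalMechanics (barlowPos barlowStacking IsHaggSeq barlowPos_mem basalMirror)
open Summit.Ventures.Crystal3D.Cruxes.TextureLiminf.TexShadow (E3 stacking)
open scoped InnerProductSpace

/-- **Lane F's graded certificate ⇒ the basal twin-pair local row at every frame** (packaging of `localSummandA_le_of_threePayer_of_gradedWin₃`). -/
theorem localEndRowA_basal_of_gradedWin₃ (h3 : TailResidue.ThreePayer) {s : ℝ} (h : TailResidue.UnionCoreGradedCapWin₃ s) (L : E3 ≃ₗᵢ[ℝ] E3) :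
    LocalEndRowA WordVersion.v2 s (basalSystem L) (basalSystem (((ℝ ∙ EuclideanSpace.single (2 : Fin 3) (1 : ℝ)).reflection).trans L)) :=
  fun _ hX _ hz hdeg => TailResidue.localSummandA_le_of_threePayer_of_gradedWin₃ h3 h L hX hz hdeg

/-- **… ⇒ the local row for the RISING IN-PLANE system of any frame, paired with itself** (antitonicity in the admissible classes: `inPlaneRoots L 1 ⊆ basalHexagon`). -/
theorem localEndRowA_inPlane_of_gradedWin₃ (h3 : TailResidue.ThreePayer) {s : ℝ} (h : TailResidue.UnionCoreGradedCapWin₃ s) (L : E3 ≃ₗᵢ[ℝ] E3) :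
    LocalEndRowA WordVersion.v2 s ⟨L, inPlaneRoots L 1⟩ ⟨L, inPlaneRoots L 1⟩ := by
  refine localEndRowA_of_systems (S₁' := basalSystem L)
    (S₂' := basalSystem (((ℝ ∙ EuclideanSpace.single (2 : Fin 3) (1 : ℝ)).reflection).trans L)) ?_ (localEndRowA_basal_of_gradedWin₃ h3 h L)
  rintro G d (hG | hG)
  · exact Or.inl (PlateSystem.adm_mono (inPlaneRoots_subset_basalHexagon L 1) hG)
  · exact Or.inl (PlateSystem.adm_mono (inPlaneRoots_subset_basalHexagon L 1) hG)

open scoped Classical in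
/-- **The bottom plate's hexagon flux bound, CONDITIONAL on lane F's graded certificate at the line `s`** (no other row hypothesis). -/
theorem hexagon_barlow_flux_le_payers_cuts_of_gradedWin₃ (h3 : TailResidue.ThreePayer) {s : ℝ} (hcert : TailResidue.UnionCoreGradedCapWin₃ s)
    {δ : ℝ} (hg : KissingGap δ) (hc : KissingClassification δ)
    {σ₁ σ₂ : ℤ → ℤ} (hσ₁ : IsHaggSeq σ₁) (hσ₂ : IsHaggSeq σ₂) (L₁ L₂ : E3 ≃ₗᵢ[ℝ] E3) (s₁ s₂ : E3)
    (Fr : E3 ≃ₗᵢ[ℝ] E3) {t : ℤ} (hFr : (t = 1 ∧ Fr = L₁) ∨ (t = -1 ∧ Fr = basalMirror.trans L₁))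
    (hne₁ : (Fr : E3 → E3) '' ↑fccSlots ≠ (L₂ : E3 → E3) '' ↑fccSlots)
    (hne₂ : (Fr : E3 → E3) '' ↑fccSlots ≠ ((basalMirror.trans L₂ : E3 ≃ₗᵢ[ℝ] E3) : E3 → E3) '' ↑fccSlots)
    (X P₁ P₂ : Finset E3) (R₀ h ρ : ℝ) (hR₀ : 5 ≤ R₀) (hh : 0 ≤ h) (hρ : R₀ + 2 ≤ ρ)
    (hX : ∀ p ∈ X, ∀ q ∈ X, p ≠ q → 1 ≤ dist p q) (hP₁X : P₁ ⊆ X) (hP₂X : P₂ ⊆ X)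
    (hP₁ : ∀ p, p ∈ P₁ ↔ (p ∈ stacking L₁ s₁ σ₁ ∧ -(2 * R₀) ≤ p 2 ∧ p 2 ≤ -R₀ ∧ p 0 ^ 2 + p 1 ^ 2 ≤ ρ ^ 2))
    (hP₂ : ∀ p, p ∈ P₂ ↔ (p ∈ stacking L₂ s₂ σ₂ ∧ h + R₀ ≤ p 2 ∧ p 2 ≤ h + 2 * R₀ ∧ p 0 ^ 2 + p 1 ^ 2 ≤ ρ ^ 2))
    (Kw : Finset ℤ) :
    ∑ k ∈ Kw, (if ¬ (σ₁ (k - 1) = -t ∧ σ₁ k = -t) then (1 : ℝ) else 0) *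
        (4 * (∑ r ∈ inPlaneRoots Fr 1, (Fr r) 2) / (Real.sqrt 3 * (1 - (L₁.symm (EuclideanSpace.single (2 : Fin 3) (1 : ℝ))) 2 ^ 2)) *
          Real.sqrt (max 0 ((ρ - 4) ^ 2 * (1 - (L₁.symm (EuclideanSpace.single (2 : Fin 3) (1 : ℝ))) 2 ^ 2) -
            ((k : ℝ) * Real.sqrt (2 / 3) + (L₁.symm s₁) 2 -
              (-(R₀ + 1) - 1) * (L₁.symm (EuclideanSpace.single (2 : Fin 3) (1 : ℝ))) 2) ^ 2)) -
          ((inPlaneRoots Fr 1).card : ℝ)) ≤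
      s * ∑ z ∈ X.filter (fun z => (X.filter fun q => dist z q = 1).card ≤ 11 ∧
          -(R₀ + 1) - 2 ≤ z 2 ∧ z 2 ≤ h + (R₀ + 1) + 2), ((12 : ℝ) - ((X.filter fun q => dist z q = 1).card : ℝ)) +
        ((∑ r ∈ inPlaneRoots Fr 1, (X.filter fun b => -(R₀ + 1) - 1 ≤ b 2 ∧ b 2 < h + (R₀ + 1) + 1 ∧
            (∃ μ, ⟪r, μ⟫_ℝ = Real.sqrt (2 / 3) ∧ IsTwinReading X Fr (Fr μ) b) ∧ b - Fr r ∈ X).card : ℕ) : ℝ) +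
        ((inPlaneRoots Fr 1).card : ℝ) *
          (220 * ((X.filter fun s => h + (R₀ + 1) + 1 ≤ s 2 ∧ s 2 ≤ h + (R₀ + 1) + 1 + 1 ∧
              (ρ - 1 - 2) ^ 2 < s 0 ^ 2 + s 1 ^ 2).card : ℝ) +
            220 * ((X.filter fun s => -(R₀ + 1) - 1 - 1 ≤ s 2 ∧ s 2 < -(R₀ + 1) - 1 ∧
              (ρ - 1 - 1) ^ 2 < s 0 ^ 2 + s 1 ^ 2).card : ℝ)) :=
  hexagon_barlow_flux_le_payers_cuts WordVersion.v2 hg hc hσ₁ hσ₂ L₁ L₂ s₁ s₂ Fr hFr hne₁ hne₂ ⟨Fr, inPlaneRoots Fr 1⟩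
    (localEndRowA_inPlane_of_gradedWin₃ h3 hcert Fr) X P₁ P₂ R₀ h ρ hR₀ hh hρ hX hP₁X hP₂X hP₁ hP₂ Kw

open scoped Classical in
/-- **The top plate's hexagon flux bound, CONDITIONAL on lane F's graded certificate at the line `s`** (the row at the mirrored frame `G₂ ≫ bM`). -/
theorem hexagon_barlow_flux_le_payers_cuts_top_of_gradedWin₃ (h3 : TailResidue.ThreePayer) {s : ℝ} (hcert : TailResidue.UnionCoreGradedCapWin₃ s)
    {δ : ℝ} (hg : KissingGap δ) (hc : KissingClassification δ)
    {σ₁ σ₂ : ℤ → ℤ} (hσ₁ : IsHaggSeq σ₁) (hσ₂ : IsHaggSeq σ₂) (L₁ L₂ : E3 ≃ₗᵢ[ℝ] E3) (s₁ s₂ : E3)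
    (G₂ : E3 ≃ₗᵢ[ℝ] E3) {t' : ℤ} (hG₂ : (t' = 1 ∧ G₂ = L₂) ∨ (t' = -1 ∧ G₂ = basalMirror.trans L₂))
    (hne₁ : (G₂ : E3 → E3) '' ↑fccSlots ≠ (L₁ : E3 → E3) '' ↑fccSlots)
    (hne₂ : (G₂ : E3 → E3) '' ↑fccSlots ≠ ((basalMirror.trans L₁ : E3 ≃ₗᵢ[ℝ] E3) : E3 → E3) '' ↑fccSlots)
    (X P₁ P₂ : Finset E3) (R₀ h ρ : ℝ) (hR₀ : 5 ≤ R₀) (hh : 0 ≤ h) (hρ : R₀ + 2 ≤ ρ)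
    (hX : ∀ p ∈ X, ∀ q ∈ X, p ≠ q → 1 ≤ dist p q) (hP₁X : P₁ ⊆ X) (hP₂X : P₂ ⊆ X)
    (hP₁ : ∀ p, p ∈ P₁ ↔ (p ∈ stacking L₁ s₁ σ₁ ∧ -(2 * R₀) ≤ p 2 ∧ p 2 ≤ -R₀ ∧ p 0 ^ 2 + p 1 ^ 2 ≤ ρ ^ 2))
    (hP₂ : ∀ p, p ∈ P₂ ↔ (p ∈ stacking L₂ s₂ σ₂ ∧ h + R₀ ≤ p 2 ∧ p 2 ≤ h + 2 * R₀ ∧ p 0 ^ 2 + p 1 ^ 2 ≤ ρ ^ 2))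
    (Kw : Finset ℤ) :
    ∑ k ∈ Kw, (if ¬ (σ₂ (k - 1) = -t' ∧ σ₂ k = -t') then (1 : ℝ) else 0) *
        (4 * (∑ r ∈ inPlaneRoots G₂ (-1), -(G₂ r) 2) / (Real.sqrt 3 * (1 - (L₂.symm (EuclideanSpace.single (2 : Fin 3) (1 : ℝ))) 2 ^ 2)) *
          Real.sqrt (max 0 ((ρ - 4) ^ 2 * (1 - (L₂.symm (EuclideanSpace.single (2 : Fin 3) (1 : ℝ))) 2 ^ 2) -
            ((k : ℝ) * Real.sqrt (2 / 3) + (L₂.symm s₂) 2 -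
              (h + (R₀ + 1) + 1) * (L₂.symm (EuclideanSpace.single (2 : Fin 3) (1 : ℝ))) 2) ^ 2)) -
          ((inPlaneRoots G₂ (-1)).card : ℝ)) ≤
      s * ∑ z ∈ X.filter (fun z => (X.filter fun q => dist z q = 1).card ≤ 11 ∧
          -(R₀ + 1) - 2 ≤ z 2 ∧ z 2 ≤ h + (R₀ + 1) + 2), ((12 : ℝ) - ((X.filter fun q => dist z q = 1).card : ℝ)) +
        ((∑ r ∈ inPlaneRoots G₂ (-1), (X.filter fun b => -(R₀ + 1) - 1 < b 2 ∧ b 2 ≤ h + (R₀ + 1) + 1 ∧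
            (∃ μ, ⟪r, μ⟫_ℝ = Real.sqrt (2 / 3) ∧ IsTwinReading X G₂ (G₂ μ) b) ∧ b - G₂ r ∈ X).card : ℕ) : ℝ) +
        ((inPlaneRoots G₂ (-1)).card : ℝ) *
          (220 * ((X.filter fun s => -(R₀ + 1) - 1 - 1 ≤ s 2 ∧ s 2 ≤ -(R₀ + 1) - 1 ∧
              (ρ - 1 - 2) ^ 2 < s 0 ^ 2 + s 1 ^ 2).card : ℝ) +
            220 * ((X.filter fun s => h + (R₀ + 1) + 1 < s 2 ∧ s 2 ≤ h + (R₀ + 1) + 1 + 1 ∧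
              (ρ - 1 - 1) ^ 2 < s 0 ^ 2 + s 1 ^ 2).card : ℝ)) :=
  hexagon_barlow_flux_le_payers_cuts_top WordVersion.v2 hg hc hσ₁ hσ₂ L₁ L₂ s₁ s₂ G₂ hG₂ hne₁ hne₂ ⟨G₂.trans basalMirror, inPlaneRoots (G₂.trans basalMirror) 1⟩
    (localEndRowA_inPlane_of_gradedWin₃ h3 hcert (G₂.trans basalMirror)) X P₁ P₂ R₀ h ρ hR₀ hh hρ hX hP₁X hP₂X hP₁ hP₂ Kw

open scoped Classical in
/-- **The HONEST two-family bound under lane F's certificate SHAPE** (two applications of the row, one per family — hence the factor `2`; `s ≥ 0`, the whole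
configuration in the cell cylinder).  See the module docstring and BETA-PLATES-g23 §5. -/
theorem hexagon_twoPlate_flux_le_twice_payerSum_of_gradedWin₃ (h3 : TailResidue.ThreePayer) {s : ℝ} (hs : 0 ≤ s)
    (hcert : TailResidue.UnionCoreGradedCapWin₃ s)
    {δ : ℝ} (hg : KissingGap δ) (hc : KissingClassification δ)
    {σ₁ σ₂ : ℤ → ℤ} (hσ₁ : IsHaggSeq σ₁) (hσ₂ : IsHaggSeq σ₂) (L₁ L₂ : E3 ≃ₗᵢ[ℝ] E3) (s₁ s₂ : E3)
    (Fr : E3 ≃ₗᵢ[ℝ] E3) {t : ℤ} (hFr : (t = 1 ∧ Fr = L₁) ∨ (t = -1 ∧ Fr = basalMirror.trans L₁))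
    (G₂ : E3 ≃ₗᵢ[ℝ] E3) {t' : ℤ} (hG₂ : (t' = 1 ∧ G₂ = L₂) ∨ (t' = -1 ∧ G₂ = basalMirror.trans L₂))
    (hne₁ : (Fr : E3 → E3) '' ↑fccSlots ≠ (L₂ : E3 → E3) '' ↑fccSlots)
    (hne₂ : (Fr : E3 → E3) '' ↑fccSlots ≠ ((basalMirror.trans L₂ : E3 ≃ₗᵢ[ℝ] E3) : E3 → E3) '' ↑fccSlots)
    (hne₁' : (G₂ : E3 → E3) '' ↑fccSlots ≠ (L₁ : E3 → E3) '' ↑fccSlots)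
    (hne₂' : (G₂ : E3 → E3) '' ↑fccSlots ≠ ((basalMirror.trans L₁ : E3 ≃ₗᵢ[ℝ] E3) : E3 → E3) '' ↑fccSlots)
    (X P₁ P₂ : Finset E3) (R₀ h ρ : ℝ) (hR₀ : 5 ≤ R₀) (hh : 0 ≤ h) (hρ : R₀ + 2 ≤ ρ)
    (hX : ∀ p ∈ X, ∀ q ∈ X, p ≠ q → 1 ≤ dist p q) (hP₁X : P₁ ⊆ X) (hP₂X : P₂ ⊆ X)
    (hcell : ∀ p ∈ X, -(2 * R₀) ≤ p 2 ∧ p 2 ≤ h + 2 * R₀ ∧ p 0 ^ 2 + p 1 ^ 2 ≤ ρ ^ 2)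
    (hP₁ : ∀ p, p ∈ P₁ ↔ (p ∈ stacking L₁ s₁ σ₁ ∧ -(2 * R₀) ≤ p 2 ∧ p 2 ≤ -R₀ ∧ p 0 ^ 2 + p 1 ^ 2 ≤ ρ ^ 2))
    (hP₂ : ∀ p, p ∈ P₂ ↔ (p ∈ stacking L₂ s₂ σ₂ ∧ h + R₀ ≤ p 2 ∧ p 2 ≤ h + 2 * R₀ ∧ p 0 ^ 2 + p 1 ^ 2 ≤ ρ ^ 2))
    (Kw₁ Kw₂ : Finset ℤ) :
    ∑ k ∈ Kw₁, (if ¬ (σ₁ (k - 1) = -t ∧ σ₁ k = -t) then (1 : ℝ) else 0) *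
        (4 * (∑ r ∈ inPlaneRoots Fr 1, (Fr r) 2) / (Real.sqrt 3 * (1 - (L₁.symm (EuclideanSpace.single (2 : Fin 3) (1 : ℝ))) 2 ^ 2)) *
          Real.sqrt (max 0 ((ρ - 4) ^ 2 * (1 - (L₁.symm (EuclideanSpace.single (2 : Fin 3) (1 : ℝ))) 2 ^ 2) -
            ((k : ℝ) * Real.sqrt (2 / 3) + (L₁.symm s₁) 2 -
              (-(R₀ + 1) - 1) * (L₁.symm (EuclideanSpace.single (2 : Fin 3) (1 : ℝ))) 2) ^ 2)) -
          ((inPlaneRoots Fr 1).card : ℝ)) +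
      ∑ k ∈ Kw₂, (if ¬ (σ₂ (k - 1) = -t' ∧ σ₂ k = -t') then (1 : ℝ) else 0) *
        (4 * (∑ r ∈ inPlaneRoots G₂ (-1), -(G₂ r) 2) / (Real.sqrt 3 * (1 - (L₂.symm (EuclideanSpace.single (2 : Fin 3) (1 : ℝ))) 2 ^ 2)) *
          Real.sqrt (max 0 ((ρ - 4) ^ 2 * (1 - (L₂.symm (EuclideanSpace.single (2 : Fin 3) (1 : ℝ))) 2 ^ 2) -
            ((k : ℝ) * Real.sqrt (2 / 3) + (L₂.symm s₂) 2 -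
              (h + (R₀ + 1) + 1) * (L₂.symm (EuclideanSpace.single (2 : Fin 3) (1 : ℝ))) 2) ^ 2)) -
          ((inPlaneRoots G₂ (-1)).card : ℝ)) ≤
      2 * s * ∑ y ∈ X.filter (fun y => (X.filter fun q => dist y q = 1).card ≠ 12 ∧ -R₀ - 2 ≤ y 2 ∧ y 2 ≤ h + R₀ + 2),
          ((12 : ℝ) - ((X.filter fun q => dist y q = 1).card : ℝ)) +
        ((∑ r ∈ inPlaneRoots Fr 1, (X.filter fun b => -(R₀ + 1) - 1 ≤ b 2 ∧ b 2 < h + (R₀ + 1) + 1 ∧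
            (∃ μ, ⟪r, μ⟫_ℝ = Real.sqrt (2 / 3) ∧ IsTwinReading X Fr (Fr μ) b) ∧ b - Fr r ∈ X).card : ℕ) : ℝ) +
        ((∑ r ∈ inPlaneRoots G₂ (-1), (X.filter fun b => -(R₀ + 1) - 1 < b 2 ∧ b 2 ≤ h + (R₀ + 1) + 1 ∧
            (∃ μ, ⟪r, μ⟫_ℝ = Real.sqrt (2 / 3) ∧ IsTwinReading X G₂ (G₂ μ) b) ∧ b - G₂ r ∈ X).card : ℕ) : ℝ) +
        (6912 * s + 1710720) * ρ := by
  have h₁ := hexagon_barlow_flux_le_payers_cuts_of_gradedWin₃ h3 hcert hg hc hσ₁ hσ₂ L₁ L₂ s₁ s₂ Fr hFr hne₁ hne₂ X P₁ P₂ R₀ h ρ hR₀ hh hρ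
    hX hP₁X hP₂X hP₁ hP₂ Kw₁
  have h₂ := hexagon_barlow_flux_le_payers_cuts_top_of_gradedWin₃ h3 hcert hg hc hσ₁ hσ₂ L₁ L₂ s₁ s₂ G₂ hG₂ hne₁' hne₂' X P₁ P₂ R₀ h ρ hR₀ hh hρ
    hX hP₁X hP₂X hP₁ hP₂ Kw₂
  have hPAYW := widenedPayerSum_le hσ₁ hσ₂ L₁ L₂ s₁ s₂ hX hP₁X hP₂X hcell hP₁ hP₂ (by linarith) (by linarith)
  have hmono := mul_le_mul_of_nonneg_left hPAYW hs
  have hsepX : ∀ (S : Finset E3), S ⊆ X → ∀ p ∈ S, ∀ q ∈ S, p ≠ q → 1 ≤ dist p q :=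
    fun S hS p hp q hq hpq => hX p (hS hp) q (hS hq) hpq
  have hrimT : ((X.filter fun s => h + (R₀ + 1) + 1 ≤ s 2 ∧ s 2 ≤ h + (R₀ + 1) + 1 + 1 ∧
      (ρ - 1 - 2) ^ 2 < s 0 ^ 2 + s 1 ^ 2).card : ℝ) ≤ 180 * ρ :=
    card_band_annulus₃_le _ (hsepX _ (filter_subset _ _)) (h + (R₀ + 1) + 1) ρ (by linarith)
      (fun p hp => by
        obtain ⟨hpX, h1, h2, h3'⟩ := mem_filter.1 hp
        exact ⟨h1, h2, h3', (hcell p hpX).2.2⟩)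
  have hrimB : ((X.filter fun s => -(R₀ + 1) - 1 - 1 ≤ s 2 ∧ s 2 < -(R₀ + 1) - 1 ∧
      (ρ - 1 - 1) ^ 2 < s 0 ^ 2 + s 1 ^ 2).card : ℝ) ≤ 144 * ρ :=
    card_band_annulus₂_le _ (hsepX _ (filter_subset _ _)) (-(R₀ + 1) - 1 - 1) ρ (by linarith)
      (fun p hp => by
        obtain ⟨hpX, h1, h2, h3'⟩ := mem_filter.1 hp
        exact ⟨h1, by linarith, h3', (hcell p hpX).2.2⟩)
  have hrim₁ : ((X.filter fun s => -(R₀ + 1) - 1 - 1 ≤ s 2 ∧ s 2 ≤ -(R₀ + 1) - 1 ∧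
      (ρ - 1 - 2) ^ 2 < s 0 ^ 2 + s 1 ^ 2).card : ℝ) ≤ 180 * ρ :=
    card_band_annulus₃_le _ (hsepX _ (filter_subset _ _)) (-(R₀ + 1) - 1 - 1) ρ (by linarith)
      (fun p hp => by
        obtain ⟨hpX, h1, h2, h3'⟩ := mem_filter.1 hp
        exact ⟨h1, by linarith, h3', (hcell p hpX).2.2⟩)
  have hrim₂ : ((X.filter fun s => h + (R₀ + 1) + 1 < s 2 ∧ s 2 ≤ h + (R₀ + 1) + 1 + 1 ∧
      (ρ - 1 - 1) ^ 2 < s 0 ^ 2 + s 1 ^ 2).card : ℝ) ≤ 144 * ρ :=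
    card_band_annulus₂_le _ (hsepX _ (filter_subset _ _)) (h + (R₀ + 1) + 1) ρ (by linarith)
      (fun p hp => by
        obtain ⟨hpX, h1, h2, h3'⟩ := mem_filter.1 hp
        exact ⟨h1.le, h2, h3', (hcell p hpX).2.2⟩)
  have hRT₁ : ((inPlaneRoots Fr 1).card : ℝ) ≤ 12 := by
    have : (inPlaneRoots Fr 1).card ≤ 12 := (card_le_card (filter_subset _ _)).trans (by rw [card_fccSlots])
    exact_mod_cast this
  have hRT₂ : ((inPlaneRoots G₂ (-1)).card : ℝ) ≤ 12 := by
    have : (inPlaneRoots G₂ (-1)).card ≤ 12 := (card_le_card (filter_subset _ _)).trans (by rw [card_fccSlots])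
    exact_mod_cast this
  have hprod : ∀ a b c : ℝ, 0 ≤ a → a ≤ 12 → 0 ≤ b → b ≤ 180 * ρ → 0 ≤ c → c ≤ 144 * ρ → a * (220 * b + 220 * c) ≤ 855360 * ρ := by
    intro a b c ha ha' hb hb' hc' hc''
    nlinarith
  have hrims₁ := hprod _ _ _ (Nat.cast_nonneg _) hRT₁ (Nat.cast_nonneg _) hrimT (Nat.cast_nonneg _) hrimB
  have hrims₂ := hprod _ _ _ (Nat.cast_nonneg _) hRT₂ (Nat.cast_nonneg _) hrim₁ (Nat.cast_nonneg _) hrim₂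
  linarith only [h₁, h₂, hmono, hrims₁, hrims₂]

end Summit.Ventures.Crystal3D.Theorems

end
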